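import Literature.Topology.FourManifolds.HomotopySpheresGroupDischarge
import Literature.Topology.FourManifolds.HomotopySpheresBPProofs
import HarnessLib

/-!
# `Θ₇` cyclic from three named facts: Smale's h-cobordism theorem, `Θ₇ = bP₈`, Cor. 7.6

Sibling proof file of `HCobordism.lean` for the named fact
`Literature.Topology.FourManifolds.exists_commGroup_homotopySphereClass_isCyclic_seven`
(`Θ₇ = HomotopySphereClass 7` carries a commutative group structure whose multiplication is the
connected sum and which is cyclic; M. Kervaire, J. Milnor, *Groups of homotopy spheres I*,
Ann. of Math. (2) 77 (1963): Thm. 1.1 p. 504, §4 with the table p. 512, Cor. 7.6 p. 530).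
Everything in this file is **proved**; no definition and no named fact is introduced (D-0026).

The assembly `exists_commGroup_homotopySphereClass_isCyclic_seven_of` (`HCobordismProofs.lean`)
consumes (A) `exists_commGroup_homotopySphereClass` — Thm. 1.1 for **all** `n ≠ 0, 4` — whose
instance `n = 3` asserts inverses in the diffeomorphism quotient of homotopy `3`-spheres and hence
rests on the Poincaré conjecture (`nonempty_diffeomorph_sphere_three`, Perelman;
`exists_commGroup_homotopySphereClass_of_hCobordism_of_poincare`, `HomotopySpheresGroupDischarge.lean`),
which Kervaire–Milnor record as open (p. 507) and which plays no role in `Θ₇`. Since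
`HomotopySpheresGroupDischarge.lean` discharged every §2 leaf of Thm. 1.1 in dimension `≥ 5`
except Smale's h-cobordism theorem (`HomotopySphereClass.groupLawFacts_of_hCobordism`), the target
now rests on exactly three named facts of the tree, none of them involving dimension `3`:

* (S15) `nonempty_diffeomorph_of_isHCobordant_of_five_le` — the smooth h-cobordism theorem
  (Smale 1962; Milnor 1965, Thm. 9.1; Kervaire–Milnor, Remark p. 505), giving Thm. 1.1 at `n = 7`
  (`exists_commGroup_homotopySphereClass_seven_of_hCobordism` below);
* (B) `HomotopySphere.boundsParallelizable_seven` — `Θ₇ = bP₈` (§4: Thm. 4.1 and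
  `Π₇ / p(S⁷) = 0`, table p. 512);
* (C) `HomotopySphereClass.isCyclic_bP_four_mul` — "`bP₄ₘ`, `m > 1`, is finite cyclic" (Cor. 7.6).

`exists_commGroup_homotopySphereClass_isCyclic_seven_of_hCobordism : (S15) → (B) → (C) → target`,
so that the discharge `exists_commGroup_homotopySphereClass_isCyclic_seven_holds` is the one-liner
`…_of_hCobordism nonempty_diffeomorph_of_isHCobordant_of_five_le_holds
HomotopySphere.boundsParallelizable_seven_holds HomotopySphereClass.isCyclic_bP_four_mul_holds`
once those three discharges land (each is the object of its own fact seat; finer frontiers over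
their current leaves are `exists_commGroup_homotopySphereClass_isCyclic_seven_of_manifoldFacts`,
`HomotopySpheresBPProofs.lean`, and
`exists_commGroup_homotopySphereClass_isCyclic_seven_of_boundsContractible`,
`HomotopySpheresSignatureReduction.lean`).

## References

* M. Kervaire, J. Milnor, *Groups of homotopy spheres I*, Ann. of Math. (2) 77 (1963), 504–537:
  Thm. 1.1 and table (p. 504), Remark (p. 505), proof of Thm. 1.1 (p. 507), §4 (Thm. 4.1 p. 510,
  table p. 512), Cor. 7.6 (p. 530). doi:10.2307/1970128 [KervaireMilnorAnnals1963]
* J. Milnor, *Lectures on the h-cobordism theorem*, Princeton (1965), Thm. 9.1. [MilnorHCobordism1965]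
* A. Kosinski, *Differential Manifolds*, Academic Press (1993), Ch. X §6, (6.6) and p. 218
  (`0 → bP⁸ → θ⁷ → Coker J₇ → 0`, `Coker J₇ = 0`, `θ⁷ = ℤ₂₈`). [Kosinski1993]
-/

noncomputable section

namespace Literature.Topology.FourManifolds

/-- **Theorem 1.1 at `n = 7` from Smale's h-cobordism theorem alone.** GIVEN the smooth
h-cobordism theorem (`nonempty_diffeomorph_of_isHCobordant_of_five_le`; Smale, Milnor 1965
Thm. 9.1), `Θ₇ = HomotopySphereClass 7` carries a commutative group structure whose
multiplication is the connected sum: the class-level group laws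
`HomotopySphereClass.groupLawFacts_of_hCobordism` (Kervaire–Milnor §2, Lemmas 2.1–2.4, all other
leaves discharged in `HomotopySpheresGroupDischarge.lean`) and the algebra of the proof of Thm. 1.1,
p. 507 (`HomotopySphereClass.GroupLawFacts.exists_commGroup`; an orientation of `𝕊⁷` exists by
`isOrientable_sphere_holds`). The instance `n = 7` of
`exists_commGroup_homotopySphereClass_of_ne_three_of_hCobordism`, in the shape consumed by
`exists_commGroup_homotopySphereClass_isCyclic_seven_of_commGroup`.
[cite: KervaireMilnorAnnals1963, Thm. 1.1 (p. 504), proof p. 507, Remark p. 505] [cite: MilnorHCobordism1965, Thm. 9.1] -/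
theorem exists_commGroup_homotopySphereClass_seven_of_hCobordism
    (hS15 : FourManifolds.nonempty_diffeomorph_of_isHCobordant_of_five_le.{0}) :
    ∃ _ : CommGroup (HomotopySphereClass 7),
      ∀ a b c : HomotopySphereClass 7, HomotopySphereClass.IsMul a b c → a * b = c := by
  obtain ⟨o₀⟩ := (isOrientable_sphere_holds 7 : Nonempty _)
  obtain ⟨inst, hmul, -, -⟩ :=
    (HomotopySphereClass.groupLawFacts_of_hCobordism (n := 7) (by norm_num) hS15).exists_commGroup o₀
  exact ⟨inst, hmul⟩

/-- **`Θ₇` is a cyclic group under connected sum, from (S15), (B), (C).** GIVEN Smale's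
h-cobordism theorem (`nonempty_diffeomorph_of_isHCobordant_of_five_le`, whence Thm. 1.1 at `n = 7`,
`exists_commGroup_homotopySphereClass_seven_of_hCobordism`), `Θ₇ = bP₈`
(`HomotopySphere.boundsParallelizable_seven`; Kervaire–Milnor §4, Thm. 4.1 with `Π₇ / p(S⁷) = 0`,
table p. 512) and "`bP₄ₘ`, `m > 1`, is finite cyclic" (`HomotopySphereClass.isCyclic_bP_four_mul`;
Cor. 7.6, p. 530), the target fact
`Literature.Topology.FourManifolds.exists_commGroup_homotopySphereClass_isCyclic_seven` holds: the
cyclic subgroup `bP₈` is all of `Θ₇`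
(`exists_commGroup_homotopySphereClass_isCyclic_seven_of_commGroup`). Unlike
`exists_commGroup_homotopySphereClass_isCyclic_seven_of`, no statement about dimension `3`
(Poincaré) is consumed. [cite: KervaireMilnorAnnals1963, Thm. 1.1, §4 p. 512 (table) and Cor. 7.6 (p. 530)] [cite: Kosinski1993, Ch. X §6, (6.6) and p. 218] -/
theorem exists_commGroup_homotopySphereClass_isCyclic_seven_of_hCobordism
    (hS15 : FourManifolds.nonempty_diffeomorph_of_isHCobordant_of_five_le.{0})
    (hB : HomotopySphere.boundsParallelizable_seven)
    (hC : HomotopySphereClass.isCyclic_bP_four_mul) :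
    exists_commGroup_homotopySphereClass_isCyclic_seven :=
  exists_commGroup_homotopySphereClass_isCyclic_seven_of_commGroup
    (exists_commGroup_homotopySphereClass_seven_of_hCobordism hS15) hB hC

end Literature.Topology.FourManifolds

end
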